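import Literature.NumberTheory.DiophantineGeometry.AVTorsionCharpolyReductionProofs
import Literature.NumberTheory.DiophantineGeometry.AVGaloisModuleProofs
import Literature.NumberTheory.GaloisRepresentations.ModPGaloisRep
import HarnessLib

/-!
# The framed mod-`p` Galois representation `ρ̄_{A,p}` of an abelian variety, and its link with
# the `p`-adic representation on `H¹` (characteristic polynomials)

Topic `NumberTheory/DiophantineGeometry`; theorems only (no definition, no named fact, no
`sorry`), sibling of `AVGaloisModule`, `AVGaloisModuleProofs`, `AVTorsionCharpolyReductionProofs`.

For an abelian variety `A` over a field `K`, a prime `p` invertible in `K` and `d = 2 dim A`: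

* `AbelianVariety.exists_framedGaloisRep_geomTorsion` — **`ρ̄ : Γ_K →ₜ* GL_d(𝔽_p)` exists**:
  there are a framed continuous representation `ρ₀ : FramedGaloisRep K (ZMod p) d` and an additive
  frame `e : A[p](K̄) ≃ (ℤ/p)^d` with `e (σ • P) = ρ₀(σ) · e(P)`.  Proof as for elliptic curves
  (`WeierstrassCurve.exists_isTorsionGaloisRep`, `BCDTModularity.lean`, whose argument is copied):
  `#A[p](K̄) = p^d` (`natCard_geomTorsion_pow'`, Mumford §6 Application 3 — unconditional in the
  tree), so `A[p]` is a `d`-dimensional `𝔽_p`-vector space; in a basis the additive (hence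
  `𝔽_p`-linear) action of `σ` is a matrix, multiplicative in `σ`; continuity for the Krull
  topology because `ρ₀` is trivial on the open subgroup `⋂_{P ∈ A[p]} Stab(P)`
  (`AbelianVariety.isOpen_stabilizer_holds`, `A[p]` finite). [cite: SerreTate1968, §1]
  [cite: MumfordAV1970, §6 Application 3 (Proposition p. 64)]
* `AbelianVariety.exists_dualFramedGaloisRep_charpoly_link` — **the residual representation of
  `H¹`, linked to the `p`-adic one.**  For any topological field `k` of characteristic `p`, any
  `ℚ_p`-basis `b` of `V_p A` and the framed DUAL `r(g) = [g⁻¹]_bᵀ ⊗ ℚ̄_p`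
  (`(V_p A)^∨ ⊗ ℚ̄_p = H¹_ét(A_K̄, ℚ̄_p)` in the dual basis — the convention of
  Boxer–Calegari–Gee–Pilloni, §1.8.11, and the shape of every `r` binder of the tree's BCGP
  facts), there is a framed `ρb : Γ_K →ₜ* GL_d(k)` — namely `ρb = (ρ₀^∨) ⊗ k`,
  `ρb(g) = ρ₀(g⁻¹)ᵀ mod (𝔽_p → k)`, the representation on `A[p]^∨ ⊗ k` — such that for every
  `g`, `P := charpoly(g⁻¹ | T_p A) ∈ ℤ_p[X]` maps to `charpoly r(g)` in `ℚ̄_p[X]` and, through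
  `ℤ_p → 𝔽_p → k`, to `charpoly ρb(g)` (`exists_charpoly_toMatrix_rationalTateRep_eq_map_and_map_eq_charpoly_torsionFrame`,
  Serre–Tate 1968, §1: `T_p/p = A[p]`, `V_p = T_p ⊗ ℚ_p`).  This is exactly the "residue of `r`"
  clause of the good-prime binder `hgood'` of
  `Literature.NumberTheory.DiophantineGeometry.bcgp_serreWreathFixedSimilitude_implies_quadraticImprimitiveSurfacesModular_of_modularityLifting_of_goodPrimes'_of_remainingTypes`
  (`BcgpSerreWreathFixedSimilitudeImprimitiveSurfacesProofs.lean`), so that a proof of that binder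
  ([BoxerEtAl2021, §9.2] good primes) may take `ρb := ρ̄_{A,p}^∨ ⊗ k` and is left with its
  genuinely arithmetic clauses (multiplier, ordinarity, images). [cite: SerreTate1968, §1]
  [cite: BoxerCalegariGeePilloni2025, §1.8.11]
* `AbelianVariety.exists_dualFramedGaloisRep_charpoly_link_surface` — the case `K = ℚ`, `d = 4`
  in the exact binder shape (`A.dim = 2`).
* `AbelianVariety.charpoly_link_dual_baseChange_of_torsionFrame` (and `…_surface`,
  `exists_framedGaloisRep_geomTorsion_surface`) — the link for a GIVEN frame `(ρ₀, e)` of `A[p]`,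
  for the explicit framed representation `(FramedRep.dual ρ₀).baseChange (𝔽_p → k)` on
  `A[p]^∨ ⊗ k`: the form in which a binder can speak of THE residual representation `ρ̄_{A,p}`;
  `FramedRep.val_dual_baseChange_apply` unfolds that representation's matrices.

## References

* J.-P. Serre, J. Tate, *Good reduction of abelian varieties*, Ann. of Math. 88 (1968), §1.
  [SerreTate1968]
* D. Mumford, *Abelian Varieties* (1970), §6 Application 3. [MumfordAV1970]
* G. Boxer, F. Calegari, T. Gee, V. Pilloni, *Modularity theorems for abelian surfaces*,
  arXiv:2502.20645 (2025), §1.8.11. [BoxerCalegariGeePilloni2025]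
* G. Boxer, F. Calegari, T. Gee, V. Pilloni, *Abelian surfaces over totally real fields are
  potentially modular*, Publ. Math. IHÉS 134 (2021), §9.2. [BoxerEtAl2021]
-/

noncomputable section

open scoped MatrixGroups
open Matrix Field

namespace Literature.NumberTheory.DiophantineGeometry

open Literature.NumberTheory.GaloisRepresentations Literature.NumberTheory.EllipticCurves
open Literature.AlgebraicGeometry.Motives (AbelianVariety)

universe u

variable {K : Type u} [Field K] (A : AbelianVariety K) (p : ℕ) [Fact p.Prime]

open scoped Classical in
/-- **The framed mod-`p` representation `ρ̄_{A,p} : Γ_K →ₜ* GL_d(𝔽_p)` of an abelian variety**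
(`d = 2 dim A`, `p` invertible in `K`): a continuous framed `ρ₀` and an additive frame
`e : A[p](K̄) ≃ (ℤ/p)^d` with `e (σ • P) = ρ₀(σ) · e(P)` for all `σ ∈ Γ_K`, `P ∈ A[p]`.
Serre–Tate 1968, §1 (`A_p = T_p/pT_p`, a `Gal(K̄/K)`-module, finite); the proof is that of
`WeierstrassCurve.exists_isTorsionGaloisRep` in every dimension. [cite: SerreTate1968, §1] -/
theorem _root_.Literature.AlgebraicGeometry.Motives.AbelianVariety.exists_framedGaloisRep_geomTorsion
    (hp : (p : K) ≠ 0) {d : ℕ} (hd : 2 * A.dim = d) :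
    ∃ (ρ₀ : FramedGaloisRep K (ZMod p) d) (e : A.geomTorsion (p : ℕ) ≃+ (Fin d → ZMod p)),
      ∀ (σ : absoluteGaloisGroup K) (P : A.geomTorsion (p : ℕ)),
        e (σ • P) = ((ρ₀ σ : GL (Fin d) (ZMod p)) : Matrix (Fin d) (Fin d) (ZMod p)) *ᵥ e P := by
  letI : Module (ZMod p) (A.geomTorsion (p : ℕ)) := AddSubgroup.torsionBy.zmodModule
  have hcard : Nat.card (A.geomTorsion (p : ℕ)) = p ^ d := by
    have h := A.natCard_geomTorsion_pow' p hp 1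
    rwa [pow_one, mul_one, hd] at h
  haveI : Finite (A.geomTorsion (p : ℕ)) := Nat.finite_of_card_ne_zero (by
    rw [hcard]; exact pow_ne_zero _ (Fact.out : p.Prime).ne_zero)
  haveI : Module.Finite (ZMod p) (A.geomTorsion (p : ℕ)) := Module.Finite.of_finite
  have hrank : Module.finrank (ZMod p) (A.geomTorsion (p : ℕ)) = d := by
    have h := Module.natCard_eq_pow_finrank (K := ZMod p) (V := A.geomTorsion (p : ℕ))
    rw [hcard, Nat.card_zmod] at h
    exact (Nat.pow_right_injective (Fact.out : p.Prime).two_le h).symm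
  let b : Module.Basis (Fin d) (ZMod p) (A.geomTorsion (p : ℕ)) :=
    Module.finBasisOfFinrankEq _ _ hrank
  -- the action of `σ` on `A[p]` as an `𝔽_p`-linear map, and its matrix in the basis `b`
  let act : absoluteGaloisGroup K → (A.geomTorsion (p : ℕ) →ₗ[ZMod p] A.geomTorsion (p : ℕ)) :=
    fun σ ↦ (DistribSMul.toAddMonoidHom (A.geomTorsion (p : ℕ)) σ).toZModLinearMap p
  have act_apply : ∀ σ (P : A.geomTorsion (p : ℕ)), act σ P = σ • P := fun _ _ ↦ rfl
  have act_one : act 1 = LinearMap.id := LinearMap.ext fun P ↦ by rw [act_apply, one_smul]; rfl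
  have act_mul : ∀ σ τ, act (σ * τ) = act σ * act τ := fun σ τ ↦ LinearMap.ext fun P ↦ by
    rw [act_apply, mul_smul]; rfl
  let φ : absoluteGaloisGroup K →* Matrix (Fin d) (Fin d) (ZMod p) :=
    { toFun := fun σ ↦ LinearMap.toMatrix b b (act σ)
      map_one' := by simp only [act_one, LinearMap.toMatrix_id]
      map_mul' := fun σ τ ↦ by simp only [act_mul, LinearMap.toMatrix_mul] }
  have φ_apply : ∀ σ, φ σ = LinearMap.toMatrix b b (act σ) := fun _ ↦ rfl
  let ρ₀ : absoluteGaloisGroup K →* GL (Fin d) (ZMod p) := φ.toHomUnits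
  -- continuity: `ρ₀` is trivial on the open subgroup of `Γ_K` fixing `A[p]` pointwise
  have hU : IsOpen {σ : absoluteGaloisGroup K |
      ∀ P : A.geomTorsion (p : ℕ), σ • (P : A.geomPoints) = P} := by
    have : {σ : absoluteGaloisGroup K | ∀ P : A.geomTorsion (p : ℕ), σ • (P : A.geomPoints) = P} =
        ⋂ P : A.geomTorsion (p : ℕ), {σ : absoluteGaloisGroup K | σ • (P : A.geomPoints) = P} := by
      ext σ
      simp only [Set.mem_setOf_eq, Set.mem_iInter]
    rw [this]
    exact isOpen_iInter_of_finite fun P ↦ A.isOpen_stabilizer_holds (P : A.geomPoints)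
  have hρ₀U : ∀ σ ∈ {σ : absoluteGaloisGroup K |
      ∀ P : A.geomTorsion (p : ℕ), σ • (P : A.geomPoints) = P}, ρ₀ σ = 1 := by
    intro σ hσ
    ext : 1
    rw [MonoidHom.coe_toHomUnits, φ_apply, Units.val_one, ← LinearMap.toMatrix_id (v₁ := b)]
    congr 1
    exact LinearMap.ext fun P ↦ Subtype.ext (hσ P)
  have hcont : Continuous ρ₀ := by
    refine continuous_of_continuousAt_one ρ₀ ?_
    rw [ContinuousAt, map_one]
    refine (tendsto_const_nhds (x := (1 : GL (Fin d) (ZMod p)))).congr' ?_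
    filter_upwards [hU.mem_nhds (fun P ↦ one_smul _ _)] with σ hσ
    exact (hρ₀U σ hσ).symm
  refine ⟨⟨ρ₀, hcont⟩, b.equivFun.toAddEquiv, fun σ P ↦ ?_⟩
  change b.equivFun (σ • P) = ((ρ₀ σ : GL (Fin d) (ZMod p)) : Matrix (Fin d) (Fin d) (ZMod p)) *ᵥ
    b.equivFun P
  rw [MonoidHom.coe_toHomUnits, φ_apply, Module.Basis.equivFun_apply, Module.Basis.equivFun_apply,
    LinearMap.toMatrix_mulVec_repr, act_apply]

/-- **The residual representation of `H¹` and its link with the `p`-adic one.**  Let `A/K` be an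
abelian variety, `p` a prime invertible in `K`, `d = 2 dim A`, `k` a topological field of
characteristic `p`, `b` a `ℚ_p`-basis of `V_p A` and `r : Γ_K →ₜ* GL_d(ℚ̄_p)` the framed dual,
`r(g) = [g⁻¹]_bᵀ ⊗ ℚ̄_p` (`H¹_ét(A_K̄, ℚ̄_p)` in the dual basis; BCGP §1.8.11).  Then there is a
framed `ρb : Γ_K →ₜ* GL_d(k)` which (i) is the base change to `k` of the dual of the mod-`p`
representation on `A[p](K̄)` — `ρb(g) = ρ₀(g⁻¹)ᵀ mod (𝔽_p → k)` for a frame `e` of `A[p]` with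
matrices `ρ₀` — and (ii) is LINKED to `r` on characteristic polynomials: for every `g` some
`P ∈ ℤ_p[X]` (namely `charpoly(g⁻¹ | T_p A)`) maps to `charpoly r(g)` in `ℚ̄_p[X]` and, through
`ℤ_p → 𝔽_p → k`, to `charpoly ρb(g)`.  Serre–Tate 1968, §1 (`T_p/p = A[p]`, `V_p = T_p ⊗ ℚ_p`),
via `exists_charpoly_toMatrix_rationalTateRep_eq_map_and_map_eq_charpoly_torsionFrame` at `g⁻¹`,
`Matrix.charpoly_transpose`, `Matrix.charpoly_map`. [cite: SerreTate1968, §1]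
[cite: BoxerCalegariGeePilloni2025, §1.8.11] -/
theorem _root_.Literature.AlgebraicGeometry.Motives.AbelianVariety.exists_dualFramedGaloisRep_charpoly_link
    (hp : (p : K) ≠ 0) {d : ℕ} (hd : 2 * A.dim = d)
    (k : Type*) [Field k] [CharP k p] [TopologicalSpace k] [IsTopologicalRing k]
    (b : Module.Basis (Fin d) ℚ_[p] (A.rationalTateModule p))
    (r : FramedGaloisRep K (PadicAlgCl p) d)
    (hr : ∀ g : absoluteGaloisGroup K,
      (r g).val = ((LinearMap.toMatrix b b (A.rationalTateRep p g⁻¹)).map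
        (algebraMap ℚ_[p] (PadicAlgCl p))).transpose) :
    ∃ ρb : FramedGaloisRep K k d,
      (∃ (ρ₀ : FramedGaloisRep K (ZMod p) d) (e : A.geomTorsion (p : ℕ) ≃+ (Fin d → ZMod p)),
        (∀ (σ : absoluteGaloisGroup K) (P : A.geomTorsion (p : ℕ)),
          e (σ • P) = ((ρ₀ σ : GL (Fin d) (ZMod p)) : Matrix (Fin d) (Fin d) (ZMod p)) *ᵥ e P) ∧
        ∀ σ : absoluteGaloisGroup K,
          (ρb σ).val = (((ρ₀ σ⁻¹ : GL (Fin d) (ZMod p)) : Matrix (Fin d) (Fin d) (ZMod p)).map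
            (ZMod.castHom (dvd_refl p) k)).transpose) ∧
      ∀ g : absoluteGaloisGroup K, ∃ P : Polynomial ℤ_[p],
        P.map (algebraMap ℤ_[p] (PadicAlgCl p)) = FramedRep.charpoly r g ∧
          P.map ((ZMod.castHom (dvd_refl p) k).comp (PadicInt.toZMod (p := p))) =
            FramedRep.charpoly ρb g := by
  obtain ⟨ρ₀, e, he⟩ := A.exists_framedGaloisRep_geomTorsion p hp hd
  set ι : ZMod p →+* k := ZMod.castHom (dvd_refl p) k with hι
  have hιc : Continuous ι := continuous_of_discreteTopology
  refine ⟨(FramedRep.dual ρ₀).baseChange ι hιc, ⟨ρ₀, e, he, fun σ ↦ ?_⟩, fun g ↦ ?_⟩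
  · rw [FramedRep.baseChange_apply]
    change ((FramedRep.dual ρ₀ σ : GL (Fin d) (ZMod p)) : Matrix (Fin d) (Fin d) (ZMod p)).map ι = _
    rw [FramedRep.coe_dual_apply, ← map_inv, Matrix.transpose_map]
  · -- the link, from `T_p/p = A[p]` and `V_p = T_p ⊗ ℚ_p` at `g⁻¹`
    obtain ⟨P, hPV, hPbar⟩ :=
      A.exists_charpoly_toMatrix_rationalTateRep_eq_map_and_map_eq_charpoly_torsionFrame p hp hd e
        (fun τ ↦ ((ρ₀ τ : GL (Fin d) (ZMod p)) : Matrix (Fin d) (Fin d) (ZMod p))) he b g⁻¹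
    refine ⟨P, ?_, ?_⟩
    · rw [FramedRep.charpoly, hr g, Matrix.charpoly_transpose, Matrix.charpoly_map, ← hPV,
        Polynomial.map_map, ← IsScalarTower.algebraMap_eq]
    · rw [← Polynomial.map_map, hPbar, FramedRep.charpoly, FramedRep.baseChange_apply]
      change _ = (((FramedRep.dual ρ₀ g : GL (Fin d) (ZMod p)) :
        Matrix (Fin d) (Fin d) (ZMod p)).map ι).charpoly
      rw [FramedRep.coe_dual_apply, ← map_inv, Matrix.charpoly_map, Matrix.charpoly_transpose]

/-- **The case of an abelian surface over `ℚ`** (`d = 4`), in the exact shape of the "residue of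
`r`" clause of the BCGP good-prime binder `hgood'`
(`BcgpSerreWreathFixedSimilitudeImprimitiveSurfacesProofs.lean`): for `A/ℚ` with `dim A = 2`, a
prime `p`, a `ℚ_p`-basis `b` of `V_p A`, the framed dual `r`, and any topological field `k` of
characteristic `p`, some framed `ρb : Γ_ℚ →ₜ* GL₄(k)` — the representation on `A[p]^∨ ⊗ k` — has
all its characteristic polynomials reductions of those of `r` through `ℤ_p[X]`.
[cite: SerreTate1968, §1] [cite: BoxerCalegariGeePilloni2025, §1.8.11] -/
theorem _root_.Literature.AlgebraicGeometry.Motives.AbelianVariety.exists_dualFramedGaloisRep_charpoly_link_surface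
    (A : AbelianVariety ℚ) (hA : A.dim = 2) (p : ℕ) [Fact p.Prime]
    (k : Type*) [Field k] [CharP k p] [TopologicalSpace k] [IsTopologicalRing k]
    (b : Module.Basis (Fin 4) ℚ_[p] (A.rationalTateModule p))
    (r : FramedGaloisRep ℚ (PadicAlgCl p) 4)
    (hr : ∀ g : absoluteGaloisGroup ℚ,
      (r g).val = ((LinearMap.toMatrix b b (A.rationalTateRep p g⁻¹)).map
        (algebraMap ℚ_[p] (PadicAlgCl p))).transpose) :
    ∃ ρb : FramedGaloisRep ℚ k 4,
      (∃ (ρ₀ : FramedGaloisRep ℚ (ZMod p) 4) (e : A.geomTorsion (p : ℕ) ≃+ (Fin 4 → ZMod p)),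
        (∀ (σ : absoluteGaloisGroup ℚ) (P : A.geomTorsion (p : ℕ)),
          e (σ • P) = ((ρ₀ σ : GL (Fin 4) (ZMod p)) : Matrix (Fin 4) (Fin 4) (ZMod p)) *ᵥ e P) ∧
        ∀ σ : absoluteGaloisGroup ℚ,
          (ρb σ).val = (((ρ₀ σ⁻¹ : GL (Fin 4) (ZMod p)) : Matrix (Fin 4) (Fin 4) (ZMod p)).map
            (ZMod.castHom (dvd_refl p) k)).transpose) ∧
      ∀ g : absoluteGaloisGroup ℚ, ∃ P : Polynomial ℤ_[p],
        P.map (algebraMap ℤ_[p] (PadicAlgCl p)) = FramedRep.charpoly r g ∧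
          P.map ((ZMod.castHom (dvd_refl p) k).comp (PadicInt.toZMod (p := p))) =
            FramedRep.charpoly ρb g :=
  A.exists_dualFramedGaloisRep_charpoly_link p
    (by exact_mod_cast (Fact.out : p.Prime).ne_zero) (by rw [hA]) k b r hr

/-- **The link for a GIVEN frame of `A[p]`.**  With `A/K`, `p`, `d`, `k`, `b`, `r` as in
`exists_dualFramedGaloisRep_charpoly_link`, for ANY framed `ρ₀ : Γ_K →ₜ* GL_d(𝔽_p)` and additive
frame `e` of `A[p](K̄)` with `e (σ • P) = ρ₀(σ) · e(P)`, the framed representation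
`ρ₀^∨ ⊗ k = (FramedRep.dual ρ₀).baseChange (𝔽_p → k)` (on `A[p]^∨ ⊗ k`) is linked to `r`: every
`charpoly r(g)` is the image of some `P ∈ ℤ_p[X]` whose image through `ℤ_p → 𝔽_p → k` is
`charpoly (ρ₀^∨ ⊗ k)(g)`.  (The form in which a binder may speak of THE residual representation
`ρ̄_{A,p}` rather than of some linked `ρb`.) [cite: SerreTate1968, §1]
[cite: BoxerCalegariGeePilloni2025, §1.8.11] -/
theorem _root_.Literature.AlgebraicGeometry.Motives.AbelianVariety.charpoly_link_dual_baseChange_of_torsionFrame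
    (hp : (p : K) ≠ 0) {d : ℕ} (hd : 2 * A.dim = d)
    (k : Type*) [Field k] [CharP k p] [TopologicalSpace k]
    (ρ₀ : FramedGaloisRep K (ZMod p) d) (e : A.geomTorsion (p : ℕ) ≃+ (Fin d → ZMod p))
    (he : ∀ (σ : absoluteGaloisGroup K) (P : A.geomTorsion (p : ℕ)),
      e (σ • P) = ((ρ₀ σ : GL (Fin d) (ZMod p)) : Matrix (Fin d) (Fin d) (ZMod p)) *ᵥ e P)
    (b : Module.Basis (Fin d) ℚ_[p] (A.rationalTateModule p))
    (r : FramedGaloisRep K (PadicAlgCl p) d)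
    (hr : ∀ g : absoluteGaloisGroup K,
      (r g).val = ((LinearMap.toMatrix b b (A.rationalTateRep p g⁻¹)).map
        (algebraMap ℚ_[p] (PadicAlgCl p))).transpose)
    (g : absoluteGaloisGroup K) :
    ∃ P : Polynomial ℤ_[p],
      P.map (algebraMap ℤ_[p] (PadicAlgCl p)) = FramedRep.charpoly r g ∧
        P.map ((ZMod.castHom (dvd_refl p) k).comp (PadicInt.toZMod (p := p))) =
          FramedRep.charpoly ((FramedRep.dual ρ₀).baseChange (ZMod.castHom (dvd_refl p) k)
            continuous_of_discreteTopology) g := by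
  obtain ⟨P, hPV, hPbar⟩ :=
    A.exists_charpoly_toMatrix_rationalTateRep_eq_map_and_map_eq_charpoly_torsionFrame p hp hd e
      (fun τ ↦ ((ρ₀ τ : GL (Fin d) (ZMod p)) : Matrix (Fin d) (Fin d) (ZMod p))) he b g⁻¹
  refine ⟨P, ?_, ?_⟩
  · rw [FramedRep.charpoly, hr g, Matrix.charpoly_transpose, Matrix.charpoly_map, ← hPV,
      Polynomial.map_map, ← IsScalarTower.algebraMap_eq]
  · rw [← Polynomial.map_map, hPbar, FramedRep.charpoly, FramedRep.baseChange_apply]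
    change _ = (((FramedRep.dual ρ₀ g : GL (Fin d) (ZMod p)) :
      Matrix (Fin d) (Fin d) (ZMod p)).map (ZMod.castHom (dvd_refl p) k)).charpoly
    rw [FramedRep.coe_dual_apply, ← map_inv, Matrix.charpoly_map, Matrix.charpoly_transpose]

/-- The surface case (`K = ℚ`, `d = 4`) of `charpoly_link_dual_baseChange_of_torsionFrame`, in
the binder shapes of the BCGP reductions. [cite: SerreTate1968, §1]
[cite: BoxerCalegariGeePilloni2025, §1.8.11] -/
theorem _root_.Literature.AlgebraicGeometry.Motives.AbelianVariety.charpoly_link_dual_baseChange_of_torsionFrame_surface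
    (A : AbelianVariety ℚ) (hA : A.dim = 2) (p : ℕ) [Fact p.Prime]
    (k : Type*) [Field k] [CharP k p] [TopologicalSpace k]
    (ρ₀ : FramedGaloisRep ℚ (ZMod p) 4) (e : A.geomTorsion (p : ℕ) ≃+ (Fin 4 → ZMod p))
    (he : ∀ (σ : absoluteGaloisGroup ℚ) (P : A.geomTorsion (p : ℕ)),
      e (σ • P) = ((ρ₀ σ : GL (Fin 4) (ZMod p)) : Matrix (Fin 4) (Fin 4) (ZMod p)) *ᵥ e P)
    (b : Module.Basis (Fin 4) ℚ_[p] (A.rationalTateModule p))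
    (r : FramedGaloisRep ℚ (PadicAlgCl p) 4)
    (hr : ∀ g : absoluteGaloisGroup ℚ,
      (r g).val = ((LinearMap.toMatrix b b (A.rationalTateRep p g⁻¹)).map
        (algebraMap ℚ_[p] (PadicAlgCl p))).transpose)
    (g : absoluteGaloisGroup ℚ) :
    ∃ P : Polynomial ℤ_[p],
      P.map (algebraMap ℤ_[p] (PadicAlgCl p)) = FramedRep.charpoly r g ∧
        P.map ((ZMod.castHom (dvd_refl p) k).comp (PadicInt.toZMod (p := p))) =
          FramedRep.charpoly ((FramedRep.dual ρ₀).baseChange (ZMod.castHom (dvd_refl p) k)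
            continuous_of_discreteTopology) g :=
  A.charpoly_link_dual_baseChange_of_torsionFrame p
    (by exact_mod_cast (Fact.out : p.Prime).ne_zero) (by rw [hA]) k ρ₀ e he b r hr g

/-- **Existence of a frame of `A[p](ℚ̄)` for an abelian surface** (`exists_framedGaloisRep_geomTorsion`
with `K = ℚ`, `d = 4`). [cite: SerreTate1968, §1] -/
theorem _root_.Literature.AlgebraicGeometry.Motives.AbelianVariety.exists_framedGaloisRep_geomTorsion_surface
    (A : AbelianVariety ℚ) (hA : A.dim = 2) (p : ℕ) [Fact p.Prime] :
    ∃ (ρ₀ : FramedGaloisRep ℚ (ZMod p) 4) (e : A.geomTorsion (p : ℕ) ≃+ (Fin 4 → ZMod p)),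
      ∀ (σ : absoluteGaloisGroup ℚ) (P : A.geomTorsion (p : ℕ)),
        e (σ • P) = ((ρ₀ σ : GL (Fin 4) (ZMod p)) : Matrix (Fin 4) (Fin 4) (ZMod p)) *ᵥ e P :=
  A.exists_framedGaloisRep_geomTorsion p (by exact_mod_cast (Fact.out : p.Prime).ne_zero)
    (by rw [hA])

/-- Unfolding: `((ρ₀^∨) ⊗_f B)(σ) = f(ρ₀(σ⁻¹))ᵀ` as a matrix, for the base change along a
continuous `f : A → B` of the dual of a framed representation. [folklore] -/
theorem _root_.Literature.NumberTheory.GaloisRepresentations.FramedRep.val_dual_baseChange_apply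
    {G : Type*} [Group G] [TopologicalSpace G] {R : Type*} [CommRing R] [TopologicalSpace R]
    [IsTopologicalRing R] {B : Type*} [CommRing B] [TopologicalSpace B] (f : R →+* B)
    (hf : Continuous f) {n : ℕ} (ρ₀ : FramedRep G R n) (σ : G) :
    ((FramedRep.dual ρ₀).baseChange f hf σ).val =
      ((((ρ₀ σ⁻¹ : GL (Fin n) R)) : Matrix (Fin n) (Fin n) R).map f).transpose := by
  rw [FramedRep.baseChange_apply]
  change ((FramedRep.dual ρ₀ σ : GL (Fin n) R) : Matrix (Fin n) (Fin n) R).map f = _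
  rw [FramedRep.coe_dual_apply, ← map_inv, Matrix.transpose_map]

end Literature.NumberTheory.DiophantineGeometry
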